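import Mathlib
import Summits.NavierStokesRegularity.NavierStokesRegularity.Theorems.EulerZoomLiouvillePowerGaugeEulerLiouvilleSelfSimilarSourceNode
import HarnessLib

/-!
# Rung C1 of the crux `EulerZoomLiouville.PowerGaugeEulerLiouville`: vorticity vanishes near every SPIRAL or nodal
# source of the similarity flow (real normal form with a rotation block) — unconditionally in the window `γ < ½`
# (route №10, item stmt-NavierStokesRegularity-19832; `--supports`)

Helper file (theorems only). Seat ns-typeII-p3 (cell ns-regularity-ideate §B, D-0081).  Part (L), generic case, of
the crux idea «hyperbolic-stagnation exclusion» (evidence #41 on the item), extending `…SelfSimilarSourceSpectral`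
(real-diagonalisable sources) to sources of `W = γy + V` whose linearisation has a COMPLEX PAIR of eigenvalues: in a
real normal-form basis `b` one has `A b₀ = d₀ b₀ − β b₁`, `A b₁ = β b₀ + d₁ b₁`, `A b₂ = d₂ b₂` (for a complex pair
`d₀ = d₁ = Re λ`, `β = Im λ`; `β = 0` is the diagonalisable case), and in the pulled-back Euclidean structure of `b`
the rotation part `β` CANCELS: `⟪R A h, R h⟫ = Σ dᵢ cᵢ²`.

* `exists_adapted_of_blockBasis` — adapted inner product with `min dᵢ ⟪Gh,h⟫ ≤ ⟪G A h,h⟫ ≤ max dᵢ ⟪Gh,h⟫`;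
* `sum_blockDiag_eq_three_mul` — `d₀ + d₁ + d₂ = tr DW(y*) = 3γ` (`div V = 0`);
* `curl_eq_zero_near_blockSource` — **THE UNCONDITIONAL NODE THEOREM (generic sources)**: `0 < γ < ½`, `y*` a zero of
  `W` with such a basis and `dᵢ > 0` ⇒ `curl V ≡ 0` on a neighbourhood of `y*`.  Every HYPERBOLIC SOURCE with
  DISTINCT eigenvalues (the generic case) has such a basis (real Jordan form), so: **in the window, the vorticity of a
  classical self-similar profile vanishes near every generic source of its similarity flow.**

Residue: sources with a defective repeated real eigenvalue (ε-scaled Jordan basis — not done); the global measure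
step (KEEP-2).  WHAT THIS IS NOT: not NS, not E, not rung C1.
[folklore; cf. ConstantinIgnatovaVicol2026Putative §3.5 Thm 3.8, Rem. 3.6]
-/
noncomputable section

-- flat `Theorems/<Route><Decl>…` files of one crux share the namespace of the crux (tree convention)
set_option linter.dupNamespace false

open MeasureTheory Set Filter Topology Metric Function InnerProductSpace
open scoped RealInnerProductSpace NNReal ContDiff

namespace Summit.NavierStokesRegularity.NavierStokesRegularity.Theorems.PowerGaugeEulerLiouville.Kelvin

open Literature.Analysis Literature.Analysis.FluidPDE

variable {γ : ℝ} {V : EuclideanSpace ℝ (Fin 3) → EuclideanSpace ℝ (Fin 3)} {P : EuclideanSpace ℝ (Fin 3) → ℝ}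

/-! ### Adapted inner product from a real eigenbasis -/

/-- **Adapted inner product from an eigenbasis.**  Let `A : ℝ³ →L ℝ³` and `b` a basis with `A (b i) = λ i • b i`
and `μ₀ ≤ λ i ≤ Λ₀`.  With `R` the coordinate map of `b` (valued in Euclidean `ℝ³`) and `G = R† ∘ R`:
`G` is symmetric, `⟪Gh,h⟫ = ‖Rh‖² ≥ g₀‖h‖²` for some `g₀ > 0`, and `μ₀⟪Gh,h⟫ ≤ ⟪G A h, h⟫ ≤ Λ₀⟪Gh,h⟫`.
[folklore] -/
theorem exists_adapted_of_blockBasis (A : EuclideanSpace ℝ (Fin 3) →L[ℝ] EuclideanSpace ℝ (Fin 3))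
    (b : Module.Basis (Fin 3) ℝ (EuclideanSpace ℝ (Fin 3))) (lam : Fin 3 → ℝ) (β : ℝ)
    (hA0 : A (b 0) = lam 0 • b 0 - β • b 1) (hA1 : A (b 1) = β • b 0 + lam 1 • b 1)
    (hA2 : A (b 2) = lam 2 • b 2)
    {μ₀ Λ₀ : ℝ} (hlo : ∀ i, μ₀ ≤ lam i) (hhi : ∀ i, lam i ≤ Λ₀) :
    ∃ G : EuclideanSpace ℝ (Fin 3) →L[ℝ] EuclideanSpace ℝ (Fin 3),
      (∀ u v : EuclideanSpace ℝ (Fin 3), ⟪G u, v⟫ = ⟪u, G v⟫) ∧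
      (∃ g₀ : ℝ, 0 < g₀ ∧ ∀ h : EuclideanSpace ℝ (Fin 3), g₀ * ‖h‖ ^ 2 ≤ ⟪G h, h⟫) ∧
      (∀ h : EuclideanSpace ℝ (Fin 3), μ₀ * ⟪G h, h⟫ ≤ ⟪G (A h), h⟫ ∧ ⟪G (A h), h⟫ ≤ Λ₀ * ⟪G h, h⟫) := by
  -- the coordinate map `R h = (b.repr h)` as a vector of Euclidean `ℝ³`
  let Rl : EuclideanSpace ℝ (Fin 3) →ₗ[ℝ] EuclideanSpace ℝ (Fin 3) :=
    (WithLp.linearEquiv 2 ℝ (Fin 3 → ℝ)).symm.toLinearMap ∘ₗ b.equivFun.toLinearMap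
  let R : EuclideanSpace ℝ (Fin 3) →L[ℝ] EuclideanSpace ℝ (Fin 3) := LinearMap.toContinuousLinearMap Rl
  have hRapp : ∀ h : EuclideanSpace ℝ (Fin 3), ∀ i, R h i = b.repr h i := fun h i => rfl
  -- coordinates in the basis
  have hcoord : ∀ x0 x1 x2 : ℝ, ∀ i : Fin 3,
      b.repr (x0 • b 0 + x1 • b 1 + x2 • b 2) i = ![x0, x1, x2] i := by
    intro x0 x1 x2 i
    simp only [map_add, map_smul, b.repr_self, Finsupp.coe_add, Finsupp.coe_smul, Pi.add_apply, Pi.smul_apply,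
      Finsupp.single_apply, smul_eq_mul]
    fin_cases i <;> simp
  -- `A h` in the basis: the rotation part `β` appears antisymmetrically
  have hAh : ∀ h : EuclideanSpace ℝ (Fin 3), A h = (lam 0 * b.repr h 0 + β * b.repr h 1) • b 0 +
      (-β * b.repr h 0 + lam 1 * b.repr h 1) • b 1 + (lam 2 * b.repr h 2) • b 2 := by
    intro h
    have hexp : h = b.repr h 0 • b 0 + b.repr h 1 • b 1 + b.repr h 2 • b 2 := by
      conv_lhs => rw [← b.sum_repr h]
      rw [Fin.sum_univ_three]
    conv_lhs => rw [hexp]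
    simp only [map_add, map_smul, hA0, hA1, hA2, smul_sub, smul_add, smul_smul]
    module
  have hRA : ∀ h : EuclideanSpace ℝ (Fin 3), R (A h) 0 = lam 0 * R h 0 + β * R h 1 ∧
      R (A h) 1 = -β * R h 0 + lam 1 * R h 1 ∧ R (A h) 2 = lam 2 * R h 2 := by
    intro h
    simp only [hRapp]
    rw [hAh h]
    refine ⟨?_, ?_, ?_⟩
    · rw [hcoord]; simp
    · rw [hcoord]; simp
    · rw [hcoord]; simp
  -- `G = R† R`
  refine ⟨(ContinuousLinearMap.adjoint R).comp R, fun u v => ?_, ?_, fun h => ?_⟩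
  · rw [ContinuousLinearMap.comp_apply, ContinuousLinearMap.comp_apply,
      ContinuousLinearMap.adjoint_inner_left, ← ContinuousLinearMap.adjoint_inner_right]
  · -- positivity: `‖h‖ ≤ C ‖R h‖` with `C = ‖R⁻¹‖`
    let Rinv : EuclideanSpace ℝ (Fin 3) →L[ℝ] EuclideanSpace ℝ (Fin 3) :=
      LinearMap.toContinuousLinearMap (b.equivFun.symm.toLinearMap ∘ₗ (WithLp.linearEquiv 2 ℝ (Fin 3 → ℝ)).toLinearMap)
    have hinv : ∀ h, Rinv (R h) = h := by
      intro h
      show b.equivFun.symm ((WithLp.linearEquiv 2 ℝ (Fin 3 → ℝ)) ((WithLp.linearEquiv 2 ℝ (Fin 3 → ℝ)).symm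
        (b.equivFun h))) = h
      rw [LinearEquiv.apply_symm_apply, LinearEquiv.symm_apply_apply]
    refine ⟨1 / (‖Rinv‖ ^ 2 + 1), by positivity, fun h => ?_⟩
    rw [ContinuousLinearMap.comp_apply, ContinuousLinearMap.adjoint_inner_left, real_inner_self_eq_norm_sq]
    have h1 : ‖h‖ ≤ ‖Rinv‖ * ‖R h‖ := by
      calc ‖h‖ = ‖Rinv (R h)‖ := by rw [hinv]
        _ ≤ ‖Rinv‖ * ‖R h‖ := Rinv.le_opNorm _
    have h2 : ‖h‖ ^ 2 ≤ ‖Rinv‖ ^ 2 * ‖R h‖ ^ 2 := by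
      rw [← mul_pow]; exact pow_le_pow_left₀ (norm_nonneg _) h1 2
    have hpos : 0 < ‖Rinv‖ ^ 2 + 1 := by positivity
    rw [div_mul_eq_mul_div, one_mul, div_le_iff₀ hpos]
    nlinarith [sq_nonneg ‖R h‖, norm_nonneg (R h)]
  · -- the pinching: `⟪G A h, h⟫ = Σ λᵢ (Rh)ᵢ²` (the `β`-terms cancel), `⟪G h, h⟫ = Σ (Rh)ᵢ²`
    rw [ContinuousLinearMap.comp_apply, ContinuousLinearMap.comp_apply, ContinuousLinearMap.adjoint_inner_left,
      ContinuousLinearMap.adjoint_inner_left, real_inner_self_eq_norm_sq]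
    obtain ⟨hR0, hR1, hR2⟩ := hRA h
    have e1 : ⟪R (A h), R h⟫ = ∑ i, lam i * (R h i * R h i) := by
      rw [EuclideanSpace.inner_eq_star_dotProduct]
      simp only [dotProduct, star_trivial, Fin.sum_univ_three]
      show R h 0 * R (A h) 0 + R h 1 * R (A h) 1 + R h 2 * R (A h) 2 = _
      rw [hR0, hR1, hR2]; ring
    have e2 : ‖R h‖ ^ 2 = ∑ i, R h i * R h i := by
      rw [EuclideanSpace.norm_eq, Real.sq_sqrt (Finset.sum_nonneg fun i _ => sq_nonneg _)]
      refine Finset.sum_congr rfl fun i _ => ?_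
      rw [Real.norm_eq_abs, sq_abs]; ring
    rw [e1, e2, Finset.mul_sum, Finset.mul_sum]
    constructor
    · exact Finset.sum_le_sum fun i _ => mul_le_mul_of_nonneg_right (hlo i) (mul_self_nonneg _)
    · exact Finset.sum_le_sum fun i _ => mul_le_mul_of_nonneg_right (hhi i) (mul_self_nonneg _)

/-! ### The diagonal of the block form sums to `3γ` -/

/-- **Trace identity**: if `DW(y*) = γI + DV(y*)` has the block form `A b₀ = d₀b₀ − βb₁`, `A b₁ = βb₀ + d₁b₁`,
`A b₂ = d₂b₂` in a basis `b`, and `div V = 0`, then `d₀ + d₁ + d₂ = 3γ`.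
[cite: ConstantinIgnatovaVicol2026Putative, §3.4.1 (div of the similarity field = 3γ)] -/
theorem sum_blockDiag_eq_three_mul (hdiv : VectorCalculus.IsDivFree V) (ystar : EuclideanSpace ℝ (Fin 3))
    (b : Module.Basis (Fin 3) ℝ (EuclideanSpace ℝ (Fin 3))) (lam : Fin 3 → ℝ) (β : ℝ)
    (hA0 : (γ • ContinuousLinearMap.id ℝ (EuclideanSpace ℝ (Fin 3)) + fderiv ℝ V ystar) (b 0) = lam 0 • b 0 - β • b 1)
    (hA1 : (γ • ContinuousLinearMap.id ℝ (EuclideanSpace ℝ (Fin 3)) + fderiv ℝ V ystar) (b 1) = β • b 0 + lam 1 • b 1)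
    (hA2 : (γ • ContinuousLinearMap.id ℝ (EuclideanSpace ℝ (Fin 3)) + fderiv ℝ V ystar) (b 2) = lam 2 • b 2) :
    lam 0 + lam 1 + lam 2 = 3 * γ := by
  set A : EuclideanSpace ℝ (Fin 3) →L[ℝ] EuclideanSpace ℝ (Fin 3) :=
    γ • ContinuousLinearMap.id ℝ (EuclideanSpace ℝ (Fin 3)) + fderiv ℝ V ystar with hAdef
  -- the trace of `A` in the basis: diagonal entries `lam i`
  have htr1 : LinearMap.trace ℝ _ (A : EuclideanSpace ℝ (Fin 3) →ₗ[ℝ] EuclideanSpace ℝ (Fin 3)) =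
      lam 0 + lam 1 + lam 2 := by
    rw [LinearMap.trace_eq_matrix_trace ℝ b, Matrix.trace, Fin.sum_univ_three]
    simp only [Matrix.diag_apply, LinearMap.toMatrix_apply, ContinuousLinearMap.coe_coe]
    rw [hA0, hA1, hA2]
    simp only [map_add, map_sub, map_smul, b.repr_self, Finsupp.coe_add, Finsupp.coe_sub, Finsupp.coe_smul,
      Pi.add_apply, Pi.sub_apply, Pi.smul_apply, Finsupp.single_apply, smul_eq_mul]
    simp
  -- the trace of `A = γ id + DV(y*)` is `3γ + div V(y*) = 3γ`
  have htr2 : LinearMap.trace ℝ _ (A : EuclideanSpace ℝ (Fin 3) →ₗ[ℝ] EuclideanSpace ℝ (Fin 3)) = 3 * γ := by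
    have hd : LinearMap.trace ℝ _ (fderiv ℝ V ystar : EuclideanSpace ℝ (Fin 3) →ₗ[ℝ] EuclideanSpace ℝ (Fin 3)) = 0 :=
      hdiv ystar
    rw [hAdef, ContinuousLinearMap.toLinearMap_add, ContinuousLinearMap.toLinearMap_smul, map_add, map_smul, hd,
      add_zero, ContinuousLinearMap.coe_id, LinearMap.trace_id, finrank_euclideanSpace, Fintype.card_fin, smul_eq_mul]
    push_cast
    ring
  rw [← htr1, htr2]

/-! ### The node theorem for generic (block-form) sources -/

/-- **VORTICITY VANISHES NEAR EVERY GENERIC (block-form) SOURCE, unconditionally in the window.**  Let `(V, P)` be a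
classical self-similar profile (`V` smooth, `‖DV‖ ≤ K`) with `0 < γ < ½`, and `y*` a zero of `W = γy + V` at which
`DW(y*) = γI + DV(y*)` has the real normal form `A b₀ = d₀b₀ − βb₁`, `A b₁ = βb₀ + d₁b₁`, `A b₂ = d₂b₂` with
`dᵢ > 0` (a spiral source for `β ≠ 0`, `d₀ = d₁`; a nodal source for `β = 0`).  Then `curl V ≡ 0` on a
neighbourhood of `y*`.  (By `div V = 0`, `Σdᵢ = 3γ`, so each `dᵢ < 3γ < 1 + γ`; the pulled-back Euclidean structure
of `b` pinches `DW(y*)` in `[min d, max d] ⊂ (0, 1+γ)` because the rotation `β` cancels.) [cite: ConstantinIgnatovaVicol2026Putative, §3.5 Thm 3.8 (strengthened: any sign of Ω(y*), no outgoing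
hypothesis, vanishing NEAR the node)] -/
theorem curl_eq_zero_near_blockSource (hV : ContDiff ℝ ∞ V) {K : ℝ} (hK : ∀ y, ‖fderiv ℝ V y‖ ≤ K)
    (hprof : IsSelfSimilarEulerProfile γ 0 V P) (hγ2 : γ < 1 / 2)
    {ystar : EuclideanSpace ℝ (Fin 3)} (hstar : selfSimilarTransport γ 0 V ystar = 0)
    (b : Module.Basis (Fin 3) ℝ (EuclideanSpace ℝ (Fin 3))) (lam : Fin 3 → ℝ) (β : ℝ)
    (hA0 : (γ • ContinuousLinearMap.id ℝ (EuclideanSpace ℝ (Fin 3)) + fderiv ℝ V ystar) (b 0) = lam 0 • b 0 - β • b 1)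
    (hA1 : (γ • ContinuousLinearMap.id ℝ (EuclideanSpace ℝ (Fin 3)) + fderiv ℝ V ystar) (b 1) = β • b 0 + lam 1 • b 1)
    (hA2 : (γ • ContinuousLinearMap.id ℝ (EuclideanSpace ℝ (Fin 3)) + fderiv ℝ V ystar) (b 2) = lam 2 • b 2)
    (hpos : ∀ i, 0 < lam i) :
    ∃ ρ : ℝ, 0 < ρ ∧ ∀ y : EuclideanSpace ℝ (Fin 3), ‖y - ystar‖ < ρ → curl V y = 0 := by
  -- eigenvalue bounds: `μ₀ = min`, `Λ₀ = max < 3γ < 1 + γ`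
  have hsum := sum_blockDiag_eq_three_mul (γ := γ) hprof.divFree ystar b lam β hA0 hA1 hA2
  set μ₀ : ℝ := min (lam 0) (min (lam 1) (lam 2)) with hμ₀
  set Λ₀ : ℝ := max (lam 0) (max (lam 1) (lam 2)) with hΛ₀
  have hμ₀pos : 0 < μ₀ := lt_min (hpos 0) (lt_min (hpos 1) (hpos 2))
  have hlo : ∀ i, μ₀ ≤ lam i := by
    intro i; fin_cases i
    · exact min_le_left _ _
    · exact (min_le_right _ _).trans (min_le_left _ _)
    · exact (min_le_right _ _).trans (min_le_right _ _)
  have hhi : ∀ i, lam i ≤ Λ₀ := by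
    intro i; fin_cases i
    · exact le_max_left _ _
    · exact (le_max_left _ _).trans (le_max_right _ _)
    · exact (le_max_right _ _).trans (le_max_right _ _)
  have hΛ₀lt : Λ₀ < 1 + γ := by
    have h0 := hpos 0; have h1 := hpos 1; have h2 := hpos 2
    have : Λ₀ < 3 * γ := by
      rw [hΛ₀]
      refine max_lt (by linarith) (max_lt (by linarith) (by linarith))
    linarith
  -- adapted inner product
  obtain ⟨G, hGsym, ⟨g₀, hg₀, hGpos⟩, hpinch⟩ :=
    exists_adapted_of_blockBasis (γ • ContinuousLinearMap.id ℝ (EuclideanSpace ℝ (Fin 3)) + fderiv ℝ V ystar)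
      b lam β hA0 hA1 hA2 hlo hhi
  have hnode : ∀ h : EuclideanSpace ℝ (Fin 3), μ₀ * ⟪G h, h⟫ ≤ ⟪G (γ • h + fderiv ℝ V ystar h), h⟫ ∧
      ⟪G (γ • h + fderiv ℝ V ystar h), h⟫ ≤ Λ₀ * ⟪G h, h⟫ := by
    intro h
    have := hpinch h
    simpa [_root_.add_apply, _root_.smul_apply, ContinuousLinearMap.id_apply] using this
  obtain ⟨r, hr, hzero⟩ := curl_eq_zero_near_adaptedSourceNode hV hK hprof hstar hGsym hg₀ hGpos hμ₀pos hΛ₀lt hnode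
  -- a Euclidean ball inside the `G`-ball: `⟪G h, h⟫ ≤ ‖G‖ ‖h‖² < r²` for `‖h‖ < r / √(‖G‖ + 1)`
  have hGn : 0 < ‖G‖ + 1 := by positivity
  refine ⟨r / Real.sqrt (‖G‖ + 1), by positivity, fun y hy => hzero y ?_⟩
  have h1 : ⟪G (y - ystar), y - ystar⟫ ≤ (‖G‖ + 1) * ‖y - ystar‖ ^ 2 := by
    calc ⟪G (y - ystar), y - ystar⟫ ≤ ‖G (y - ystar)‖ * ‖y - ystar‖ := real_inner_le_norm _ _
      _ ≤ ‖G‖ * ‖y - ystar‖ * ‖y - ystar‖ := mul_le_mul_of_nonneg_right (G.le_opNorm _) (norm_nonneg _)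
      _ ≤ (‖G‖ + 1) * ‖y - ystar‖ ^ 2 := by nlinarith [norm_nonneg (y - ystar), norm_nonneg G]
  have h2 : ‖y - ystar‖ * Real.sqrt (‖G‖ + 1) < r := by
    rwa [lt_div_iff₀ (Real.sqrt_pos.2 hGn)] at hy
  have h3 : (‖G‖ + 1) * ‖y - ystar‖ ^ 2 < r ^ 2 := by
    have h4 : (‖y - ystar‖ * Real.sqrt (‖G‖ + 1)) ^ 2 < r ^ 2 :=
      pow_lt_pow_left₀ h2 (by positivity) two_ne_zero
    rw [mul_pow, Real.sq_sqrt hGn.le] at h4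
    linarith
  exact lt_of_le_of_lt h1 h3

end Summit.NavierStokesRegularity.NavierStokesRegularity.Theorems.PowerGaugeEulerLiouville.Kelvin

end
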